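import Summits.ResolutionOfSingularities.ResolutionOfSingularities.Theorems.DeltaCutRefCertificates2
import HarnessLib

/-!
# DeltaCutRefCertificates3 — decomp-res node «RefCut (certificates)» (lens-6 g27, critic row 204 CLEARED (F-curve
WHOLE) DECIDED +1 · MAP 0), tree file 3/5 of the node

Content VERBATIM from the decomp-res lens-6 g27 certificate file
`HOME/decomp-res-lens-6/g27/RefCutCertificates.lean` (pin 745ed495; ring level, imports the landed
`DeltaCutSepCertificates5`; namespace `…Theorems.DeltaCutClasses`, section `RefCertificates`); HOME =
run/shared/lean/pub/decomp-res; critic CRITIC-LEDGER row 204 CLEARED (F-curve WHOLE) DECIDED +1 · MAP 0; landing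
orders NEXT-g28.md §4 (F) + INBOX :1315 — provenance, critic text and the lens header in full in the first
certificate file `DeltaCutRefCertificates`.  `--kind proof --supports stmt-ResolutionOfSingularities-26971`.

## This file

Continuation 3/5 of `DeltaCutRefCertificates` (same namespace / sections of the node, cut at the tree's 400-line
cap; section variables / opens replayed): scopes `RefCertificates` — carries `Cx_B_lineChart_X3_line`,
`Cx_C_lineChart_X0`, `Cx_C_lineChart_X1`, `Cx_C_lineChart_X2`, `Cx_C_lineChart_X0_noTop`, `Cx_C_lineChart_X2_top`,
`Cx_C_curves`, `Cx_C_dd`, `Cx_h_separable`, `Cx_C_tame_lambda`, `Cx_C_tame_mu`, `Cx_C_wild_near_Q`, `Cx_C_isPinf`.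

[WRITER NOTE (decomp-res writer g13): file split only (tree files ≤ 400 lines, cut at declaration boundaries);
namespace, the section `RefCertificates` with its `open MvPolynomial` / `variable {K : Type*} [Field K]`, and every
declaration exactly as in the lens (the HOME-only dupNamespace-linter line is dropped — the library sets it;
`noncomputable section`, the file-level `open` lines, `universe u` and `open …Rescue.BedZpeBinom4Centre
(mul_mem_pow_add)` are replayed in every part).]

(Sources: Hironaka1967; CossartJannsenSaito2020 Def. 3.13 / Thm. 3.14, Ch. 8, Thm. 9.6; Hironaka1970;
CossartPiltant2019 Prop. 2.6; CossartPiltant2008 §2; Giraud1975; Hironaka2005; EGAIV4 §16–§18; StacksProject 0804 /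
0BIQ / 031I / 039P; Matsumura1987 §28–§30; Kollar2007 Thm. 1.101.)
-/

noncomputable section

open CategoryTheory CategoryTheory.Limits AlgebraicGeometry TopologicalSpace IsLocalRing
open Literature.AlgebraicGeometry.Resolution

universe u

open Summit.ResolutionOfSingularities.ResolutionOfSingularities.Theorems.Rescue.BedZpeBinom4Centre (mul_mem_pow_add)

namespace Summit.ResolutionOfSingularities.ResolutionOfSingularities.Theorems.DeltaCutClasses

open Summit.ResolutionOfSingularities.ResolutionOfSingularities.Theorems.TwistCutClasses
open Summit.ResolutionOfSingularities.ResolutionOfSingularities.Theorems.LightCutClasses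

section RefCertificates

open MvPolynomial
variable {K : Type*} [Field K]

/-- **chart `w'` — the line `m = V(a, b, u)` lies in the top locus, is a LINE, and is WILD everywhere**: `g₂ ∈
P_m³`, `w' ∉ P_m`,
`g₂ = a³ + r`, `r = u w'(b⁴ + u⁴) ∈ P_m⁵`; NEAR over every point of `m` by the generic form `α³ + β·b²·E` of
`Cx_A_near` (chart `b` at
`(0,0,0,w₀)`: `E = (w₀ + γ b)(1 + β⁴)`).  So bad₂ ⊇ all closed points of `m` (and of its mirror `m'`, and of `L ∖
{O_u, O_w}` unchanged):
bad₂ = `L̃`. [new; elementary] [folklore] -/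
theorem Cx_B_lineChart_X3_line :
    (X 0 ^ 3 + X 2 * X 3 * (X 1 ^ 4 + X 2 ^ 4) : MvPolynomial (Fin 4) K) ∈ (Ideal.span {(X 0 : MvPolynomial (Fin 4) K), X 1, X 2}) ^ 3 ∧
      (X 3 : MvPolynomial (Fin 4) K) ∉ Ideal.span {(X 0 : MvPolynomial (Fin 4) K), X 1, X 2} ∧
      (X 2 * X 3 * (X 1 ^ 4 + X 2 ^ 4) : MvPolynomial (Fin 4) K) ∈ (Ideal.span {(X 0 : MvPolynomial (Fin 4) K), X 1, X 2}) ^ 5 := by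
  have hl0 : (X 0 : MvPolynomial (Fin 4) K) ∈ Ideal.span {(X 0 : MvPolynomial (Fin 4) K), X 1, X 2} := Ideal.subset_span (by simp)
  have hl1 : (X 1 : MvPolynomial (Fin 4) K) ∈ Ideal.span {(X 0 : MvPolynomial (Fin 4) K), X 1, X 2} := Ideal.subset_span (by simp)
  have hl2 : (X 2 : MvPolynomial (Fin 4) K) ∈ Ideal.span {(X 0 : MvPolynomial (Fin 4) K), X 1, X 2} := Ideal.subset_span (by simp)
  have hr : (X 2 * X 3 * (X 1 ^ 4 + X 2 ^ 4) : MvPolynomial (Fin 4) K) ∈ (Ideal.span {(X 0 : MvPolynomial (Fin 4) K), X 1, X 2}) ^ 5 := by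
    have h14 : (X 1 ^ 4 + X 2 ^ 4 : MvPolynomial (Fin 4) K) ∈ (Ideal.span {(X 0 : MvPolynomial (Fin 4) K), X 1, X 2}) ^ 4 :=
      Ideal.add_mem _ (Ideal.pow_mem_pow hl1 4) (Ideal.pow_mem_pow hl2 4)
    have h2 : (X 2 * X 3 : MvPolynomial (Fin 4) K) ∈ (Ideal.span {(X 0 : MvPolynomial (Fin 4) K), X 1, X 2}) ^ 1 := by
      rw [pow_one]; exact Ideal.mul_mem_right _ _ hl2
    exact mul_mem_pow_add h2 h14
  refine ⟨?_, ?_, hr⟩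
  · exact Ideal.add_mem _ (Ideal.pow_mem_pow hl0 3) (Ideal.pow_le_pow_right (by norm_num) hr)
  · refine not_mem_span_of_eval _ (fun i => if i = 3 then 1 else 0) ?_ (by simp)
    intro g hg
    simp only [Set.mem_insert_iff, Set.mem_singleton_iff] at hg
    rcases hg with rfl | rfl | rfl <;> simp

/-! #### R2 → R3 — FIRST SEPARATING HOP: the blow-up of `L̃ = V(a, b, u)` in chart-`w'` coordinates (`linChartSubst {0,1,2}`) -/

/-- chart `a`: `g₂(a, b a, u a, w') = a³·(1 + a²·u·w'·(b⁴ + u⁴))`. [new; elementary] [folklore] -/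
theorem Cx_C_lineChart_X0 :
    aeval (linChartSubst (K := K) {0, 1, 2} 0) (X 0 ^ 3 + X 2 * X 3 * (X 1 ^ 4 + X 2 ^ 4) : MvPolynomial (Fin 4) K) =
      X 0 ^ 3 * (1 + X 0 ^ 2 * X 2 * X 3 * (X 1 ^ 4 + X 2 ^ 4)) := by
  simp [linChartSubst]; ring

/-- chart `b`: `g₂(α b, b, γ b, w') = b³·(α³ + b²·γ·w'·(1 + γ⁴))` =: `b³·g₃'` (NOT a renaming of `g₃`: the extra
factor `γ` is the top
curve `ν`). [new; elementary] [folklore] -/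
theorem Cx_C_lineChart_X1 :
    aeval (linChartSubst (K := K) {0, 1, 2} 1) (X 0 ^ 3 + X 2 * X 3 * (X 1 ^ 4 + X 2 ^ 4) : MvPolynomial (Fin 4) K) =
      X 1 ^ 3 * (X 0 ^ 3 + X 1 ^ 2 * X 2 * X 3 * (1 + X 2 ^ 4)) := by
  simp [linChartSubst]; ring

/-- chart `u`: `g₂(α u, β u, u, w') = u³·(α³ + u²·w'·(β⁴ + 1))` =: `u³·g₃`. [new; elementary] [folklore] -/
theorem Cx_C_lineChart_X2 :
    aeval (linChartSubst (K := K) {0, 1, 2} 2) (X 0 ^ 3 + X 2 * X 3 * (X 1 ^ 4 + X 2 ^ 4) : MvPolynomial (Fin 4) K) =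
      X 2 ^ 3 * (X 0 ^ 3 + X 2 ^ 2 * X 3 * (X 1 ^ 4 + 1)) := by
  simp [linChartSubst]; ring

/-- **chart `a` — NO top point**: `1 + a²uw'(b⁴+u⁴)` (`∂_{w'}`: `a²u(b⁴+u⁴) ∈ 𝔮`, then `1 ∈ 𝔮`). [new; elementary] [folklore] -/
theorem Cx_C_lineChart_X0_noTop (𝔮 : Ideal (MvPolynomial (Fin 4) K)) [𝔮.IsPrime] {s : MvPolynomial (Fin 4) K} (hs : s ∉ 𝔮)
    (h : s * (1 + X 0 ^ 2 * X 2 * X 3 * (X 1 ^ 4 + X 2 ^ 4) : MvPolynomial (Fin 4) K) ∈ 𝔮 ^ 3) : False := by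
  have hs2 : s ^ 2 ∉ 𝔮 := pow_not_mem 𝔮 hs 2
  have e30 := f_ne K (i := 3) (j := 0) (by decide)
  have e31 := f_ne K (i := 3) (j := 1) (by decide)
  have e32 := f_ne K (i := 3) (j := 2) (by decide)
  have e33 := f_self K 3
  have d3 : pderiv 3 (1 + X 0 ^ 2 * X 2 * X 3 * (X 1 ^ 4 + X 2 ^ 4) : MvPolynomial (Fin 4) K) = X 0 ^ 2 * X 2 * (X 1 ^ 4 + X 2 ^ 4) := by
    simp only [map_add, Derivation.leibniz, Derivation.leibniz_pow, smul_eq_mul, nsmul_eq_mul, e30, e31, e32, e33, f_one]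
    push_cast; ring
  have h3 := sq_mul_deriv_mem_pow 𝔮 h (pderiv 3)
  rw [d3] at h3
  have hk : (X 0 ^ 2 * X 2 * (X 1 ^ 4 + X 2 ^ 4) : MvPolynomial (Fin 4) K) ∈ 𝔮 :=
    (‹𝔮.IsPrime›.mem_or_mem (Ideal.pow_le_self two_ne_zero h3)).resolve_left hs2
  have hf : (1 + X 0 ^ 2 * X 2 * X 3 * (X 1 ^ 4 + X 2 ^ 4) : MvPolynomial (Fin 4) K) ∈ 𝔮 := mem_of_sMul_mem_cube 𝔮 hs h
  have h1mem : (1 : MvPolynomial (Fin 4) K) ∈ 𝔮 := by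
    have := Ideal.sub_mem _ hf (Ideal.mul_mem_left _ (X 3) hk)
    rwa [show (1 + X 0 ^ 2 * X 2 * X 3 * (X 1 ^ 4 + X 2 ^ 4) - X 3 * (X 0 ^ 2 * X 2 * (X 1 ^ 4 + X 2 ^ 4)) :
      MvPolynomial (Fin 4) K) = 1 by ring] at this
  exact one_not_mem_of_isPrime 𝔮 h1mem

/-- **chart `u` — THE TOP LOCUS of `g₃ = α³ + u²·w'·h(β)`, `h = β⁴ + 1`, is `λ ∪ μ`**: a prime of order `≥ 3`
contains `α`, `u`, and
`w'` or `h` (`∂_{w'}`: `s²u²h ∈ 𝔮²`, then `∂_β`: `u²β³` and `∂_u`: `u h` ⟹ `u ∈ 𝔮` (else `β, h ∈ 𝔮`, `1 = h − β⁴ ∈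
𝔮`); `∂_u∂_u`:
`w'h ∈ 𝔮`; `α³`). [new; elementary] [folklore] -/
theorem Cx_C_lineChart_X2_top [CharP K 3] (𝔮 : Ideal (MvPolynomial (Fin 4) K)) [𝔮.IsPrime] {s : MvPolynomial (Fin 4) K}
    (hs : s ∉ 𝔮) (h : s * (X 0 ^ 3 + X 2 ^ 2 * X 3 * (X 1 ^ 4 + 1) : MvPolynomial (Fin 4) K) ∈ 𝔮 ^ 3) :
    (X 0 : MvPolynomial (Fin 4) K) ∈ 𝔮 ∧ (X 2 : MvPolynomial (Fin 4) K) ∈ 𝔮 ∧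
      ((X 3 : MvPolynomial (Fin 4) K) ∈ 𝔮 ∨ (X 1 ^ 4 + 1 : MvPolynomial (Fin 4) K) ∈ 𝔮) := by
  have hs2 : s ^ 2 ∉ 𝔮 := pow_not_mem 𝔮 hs 2
  have hs4 : (s ^ 2) ^ 2 ∉ 𝔮 := pow_not_mem 𝔮 hs2 2
  have h4 : (4 : MvPolynomial (Fin 4) K) ∉ 𝔮 := by
    have := natCast_not_mem (K := K) 𝔮 (m := 4) (by decide)
    exact_mod_cast this
  have h2 : (2 : MvPolynomial (Fin 4) K) ∉ 𝔮 := two_not_mem (K := K) 𝔮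
  have e12 := f_ne K (i := 1) (j := 2) (by decide)
  have e20 := f_ne K (i := 2) (j := 0) (by decide)
  have e21 := f_ne K (i := 2) (j := 1) (by decide)
  have e23 := f_ne K (i := 2) (j := 3) (by decide)
  have e30 := f_ne K (i := 3) (j := 0) (by decide)
  have e31 := f_ne K (i := 3) (j := 1) (by decide)
  have e32 := f_ne K (i := 3) (j := 2) (by decide)
  have e11 := f_self K 1
  have e22 := f_self K 2
  have e33 := f_self K 3
  have d3 : pderiv 3 (X 0 ^ 3 + X 2 ^ 2 * X 3 * (X 1 ^ 4 + 1) : MvPolynomial (Fin 4) K) = X 2 ^ 2 * (X 1 ^ 4 + 1) := by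
    simp only [map_add, Derivation.leibniz, Derivation.leibniz_pow, smul_eq_mul, nsmul_eq_mul, e30, e31, e32, e33, f_one]
    push_cast; ring
  have d31 : pderiv 1 (X 2 ^ 2 * (X 1 ^ 4 + 1) : MvPolynomial (Fin 4) K) = 4 * (X 2 ^ 2 * X 1 ^ 3) := by
    simp only [map_add, Derivation.leibniz, Derivation.leibniz_pow, smul_eq_mul, nsmul_eq_mul, e11, e12, f_one]
    push_cast; ring
  have d32 : pderiv 2 (X 2 ^ 2 * (X 1 ^ 4 + 1) : MvPolynomial (Fin 4) K) = 2 * (X 2 * (X 1 ^ 4 + 1)) := by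
    simp only [map_add, Derivation.leibniz, Derivation.leibniz_pow, smul_eq_mul, nsmul_eq_mul, e21, e22, f_one]
    push_cast; ring
  have d2 : pderiv 2 (X 0 ^ 3 + X 2 ^ 2 * X 3 * (X 1 ^ 4 + 1) : MvPolynomial (Fin 4) K) = 2 * (X 2 * X 3 * (X 1 ^ 4 + 1)) := by
    simp only [map_add, Derivation.leibniz, Derivation.leibniz_pow, smul_eq_mul, nsmul_eq_mul, e20, e21, e22, e23, f_one]
    push_cast; ring
  have d22 : pderiv 2 (2 * (X 2 * X 3 * (X 1 ^ 4 + 1)) : MvPolynomial (Fin 4) K) = 2 * (X 3 * (X 1 ^ 4 + 1)) := by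
    simp only [map_add, Derivation.leibniz, Derivation.leibniz_pow, smul_eq_mul, nsmul_eq_mul, e21, e22, e23, f_one, f_two]
    push_cast; ring
  -- membership extraction helpers
  have mem_c : ∀ {c x : MvPolynomial (Fin 4) K}, c ∉ 𝔮 → (s ^ 2) ^ 2 * (c * x) ∈ 𝔮 → x ∈ 𝔮 := fun hc hx => by
    rcases ‹𝔮.IsPrime›.mem_or_mem hx with h' | h'
    · exact absurd h' hs4
    exact (‹𝔮.IsPrime›.mem_or_mem h').resolve_left hc
  have h3 := sq_mul_deriv_mem_pow 𝔮 h (pderiv 3)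
  rw [d3] at h3
  have h31 := sq_mul_deriv_mem_pow 𝔮 h3 (pderiv 1)
  rw [d31, pow_one] at h31
  have h32 := sq_mul_deriv_mem_pow 𝔮 h3 (pderiv 2)
  rw [d32, pow_one] at h32
  have hA : (X 2 ^ 2 * X 1 ^ 3 : MvPolynomial (Fin 4) K) ∈ 𝔮 := mem_c h4 h31
  have hB : (X 2 * (X 1 ^ 4 + 1) : MvPolynomial (Fin 4) K) ∈ 𝔮 := mem_c h2 h32
  have hX2 : (X 2 : MvPolynomial (Fin 4) K) ∈ 𝔮 := by
    by_contra hX2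
    have hX1 : (X 1 : MvPolynomial (Fin 4) K) ∈ 𝔮 := by
      rcases ‹𝔮.IsPrime›.mem_or_mem hA with h' | h'
      · exact absurd (‹𝔮.IsPrime›.mem_of_pow_mem 2 h') hX2
      · exact ‹𝔮.IsPrime›.mem_of_pow_mem 3 h'
    have hh : (X 1 ^ 4 + 1 : MvPolynomial (Fin 4) K) ∈ 𝔮 := (‹𝔮.IsPrime›.mem_or_mem hB).resolve_left hX2
    have h1mem : (1 : MvPolynomial (Fin 4) K) ∈ 𝔮 := by
      have := Ideal.sub_mem _ hh (Ideal.pow_mem_of_mem 𝔮 hX1 4 (by norm_num))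
      rwa [add_sub_cancel_left] at this
    exact one_not_mem_of_isPrime 𝔮 h1mem
  have h2' := sq_mul_deriv_mem_pow 𝔮 h (pderiv 2)
  rw [d2] at h2'
  have h22 := sq_mul_deriv_mem_pow 𝔮 h2' (pderiv 2)
  rw [d22, pow_one] at h22
  have hC : (X 3 * (X 1 ^ 4 + 1) : MvPolynomial (Fin 4) K) ∈ 𝔮 := mem_c h2 h22
  have hf : (X 0 ^ 3 + X 2 ^ 2 * X 3 * (X 1 ^ 4 + 1) : MvPolynomial (Fin 4) K) ∈ 𝔮 := mem_of_sMul_mem_cube 𝔮 hs h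
  have hX0 : (X 0 : MvPolynomial (Fin 4) K) ∈ 𝔮 := by
    refine ‹𝔮.IsPrime›.mem_of_pow_mem 3 ?_
    have := Ideal.sub_mem _ hf
      (Ideal.mul_mem_right (X 1 ^ 4 + 1) _ (Ideal.mul_mem_right (X 3) _ (Ideal.pow_mem_of_mem 𝔮 hX2 2 (by norm_num))))
    rwa [add_sub_cancel_right] at this
  exact ⟨hX0, hX2, ‹𝔮.IsPrime›.mem_or_mem hC⟩

/-- **chart `u` — the two TOP CURVES `λ = V(α, u, w')` and `μ = V(α, u, h)`**: `g₃ ∈ P_λ³`, `g₃ ∈ (α, u, h)³`; `λ`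
is a LINE (`β ∉ P_λ`) and
`μ` is a CURVE (`w' ∉ (α, u, h)`: `h = β⁴ + 1` is not a unit of `K[β]`). [new; elementary] [folklore] -/
theorem Cx_C_curves :
    (X 0 ^ 3 + X 2 ^ 2 * X 3 * (X 1 ^ 4 + 1) : MvPolynomial (Fin 4) K) ∈ (Ideal.span {(X 0 : MvPolynomial (Fin 4) K), X 2, X 3}) ^ 3 ∧
      (X 0 ^ 3 + X 2 ^ 2 * X 3 * (X 1 ^ 4 + 1) : MvPolynomial (Fin 4) K) ∈
        (Ideal.span {(X 0 : MvPolynomial (Fin 4) K), X 2, X 1 ^ 4 + 1}) ^ 3 ∧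
      (X 1 : MvPolynomial (Fin 4) K) ∉ Ideal.span {(X 0 : MvPolynomial (Fin 4) K), X 2, X 3} ∧
      (X 3 : MvPolynomial (Fin 4) K) ∉ Ideal.span {(X 0 : MvPolynomial (Fin 4) K), X 2, X 1 ^ 4 + 1} := by
  have hl0 : (X 0 : MvPolynomial (Fin 4) K) ∈ Ideal.span {(X 0 : MvPolynomial (Fin 4) K), X 2, X 3} := Ideal.subset_span (by simp)
  have hl2 : (X 2 : MvPolynomial (Fin 4) K) ∈ Ideal.span {(X 0 : MvPolynomial (Fin 4) K), X 2, X 3} := Ideal.subset_span (by simp)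
  have hl3 : (X 3 : MvPolynomial (Fin 4) K) ∈ Ideal.span {(X 0 : MvPolynomial (Fin 4) K), X 2, X 3} := Ideal.subset_span (by simp)
  have hm0 : (X 0 : MvPolynomial (Fin 4) K) ∈ Ideal.span {(X 0 : MvPolynomial (Fin 4) K), X 2, X 1 ^ 4 + 1} :=
    Ideal.subset_span (by simp)
  have hm2 : (X 2 : MvPolynomial (Fin 4) K) ∈ Ideal.span {(X 0 : MvPolynomial (Fin 4) K), X 2, X 1 ^ 4 + 1} :=
    Ideal.subset_span (by simp)
  have hmh : (X 1 ^ 4 + 1 : MvPolynomial (Fin 4) K) ∈ Ideal.span {(X 0 : MvPolynomial (Fin 4) K), X 2, X 1 ^ 4 + 1} :=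
    Ideal.subset_span (by simp)
  refine ⟨?_, ?_, ?_, ?_⟩
  · refine Ideal.add_mem _ (Ideal.pow_mem_pow hl0 3) ?_
    have h23 : (X 2 ^ 2 * X 3 : MvPolynomial (Fin 4) K) ∈ (Ideal.span {(X 0 : MvPolynomial (Fin 4) K), X 2, X 3}) ^ (2 + 1) :=
      mul_mem_pow_add (Ideal.pow_mem_pow hl2 2) (by rw [pow_one]; exact hl3)
    exact Ideal.mul_mem_right _ _ h23
  · refine Ideal.add_mem _ (Ideal.pow_mem_pow hm0 3) ?_
    have h2h : (X 2 ^ 2 * (X 1 ^ 4 + 1) : MvPolynomial (Fin 4) K) ∈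
        (Ideal.span {(X 0 : MvPolynomial (Fin 4) K), X 2, X 1 ^ 4 + 1}) ^ (2 + 1) :=
      mul_mem_pow_add (Ideal.pow_mem_pow hm2 2) (by rw [pow_one]; exact hmh)
    rw [show (X 2 ^ 2 * X 3 * (X 1 ^ 4 + 1) : MvPolynomial (Fin 4) K) = X 3 * (X 2 ^ 2 * (X 1 ^ 4 + 1)) by ring]
    exact Ideal.mul_mem_left _ _ h2h
  · refine not_mem_span_of_eval _ (fun i => if i = 1 then 1 else 0) ?_ (by simp)
    intro g hg
    simp only [Set.mem_insert_iff, Set.mem_singleton_iff] at hg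
    rcases hg with rfl | rfl | rfl <;> simp
  · intro hmem
    let ψ : MvPolynomial (Fin 4) K →ₐ[K] Polynomial K :=
      aeval (fun j => if j = 1 then Polynomial.X else if j = 3 then 1 else 0)
    have hle : Ideal.span {(X 0 : MvPolynomial (Fin 4) K), X 2, X 1 ^ 4 + 1} ≤
        (Ideal.span {(Polynomial.X ^ 4 + 1 : Polynomial K)}).comap ψ.toRingHom := by
      rw [Ideal.span_le]
      intro g hg
      simp only [Set.mem_insert_iff, Set.mem_singleton_iff] at hg
      rw [SetLike.mem_coe, Ideal.mem_comap]
      rcases hg with rfl | rfl | rfl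
      · simp [ψ]
      · simp [ψ]
      · have e : ψ.toRingHom (X 1 ^ 4 + 1 : MvPolynomial (Fin 4) K) = Polynomial.X ^ 4 + 1 := by simp [ψ]
        rw [e]; exact Ideal.subset_span rfl
    have h1 := hle hmem
    rw [Ideal.mem_comap] at h1
    have e3 : ψ.toRingHom (X 3 : MvPolynomial (Fin 4) K) = 1 := by simp [ψ]
    rw [e3, Ideal.mem_span_singleton] at h1
    have hu : IsUnit (Polynomial.X ^ 4 + 1 : Polynomial K) := isUnit_of_dvd_one h1
    have hdeg : (Polynomial.X ^ 4 + 1 : Polynomial K).natDegree = 4 := by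
      rw [show (1 : Polynomial K) = Polynomial.C 1 from Polynomial.C_1.symm, Polynomial.natDegree_X_pow_add_C]
    have h0 := Polynomial.natDegree_eq_zero_of_isUnit hu
    omega

/-- `∂_u∂_u g₃ = 2·(w'·h)` — the order-`2` absolute differential operator extracting the tame element along `λ ∪ μ`.
[elementary] [folklore] -/
theorem Cx_C_dd : (pderiv 2) ((pderiv 2) (X 0 ^ 3 + X 2 ^ 2 * X 3 * (X 1 ^ 4 + 1) : MvPolynomial (Fin 4) K)) = 2 * (X 3 * (X 1 ^ 4 + 1)) := by
  have e20 := f_ne K (i := 2) (j := 0) (by decide)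
  have e21 := f_ne K (i := 2) (j := 1) (by decide)
  have e23 := f_ne K (i := 2) (j := 3) (by decide)
  have e22 := f_self K 2
  have d2 : pderiv 2 (X 0 ^ 3 + X 2 ^ 2 * X 3 * (X 1 ^ 4 + 1) : MvPolynomial (Fin 4) K) = 2 * (X 2 * X 3 * (X 1 ^ 4 + 1)) := by
    simp only [map_add, Derivation.leibniz, Derivation.leibniz_pow, smul_eq_mul, nsmul_eq_mul, e20, e21, e22, e23, f_one]
    push_cast; ring
  rw [d2]
  simp only [map_add, Derivation.leibniz, Derivation.leibniz_pow, smul_eq_mul, nsmul_eq_mul, e21, e22, e23, f_one, f_two]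
  push_cast; ring

/-- **`h = β⁴ + 1` IS SEPARABLE**: `∂_β h = 4β³ = β³` and at a prime containing `h`, `β ∉ 𝔮` (else `1 ∈ 𝔮`), so `∂_β
h ∉ 𝔮` — the points
`Q` are étale over their images and `(α, h, u, w')` is a regular system of parameters there (dictionary (E)).
[elementary] [folklore] -/
theorem Cx_h_separable (𝔮 : Ideal (MvPolynomial (Fin 4) K)) [𝔮.IsPrime] (hh : (X 1 ^ 4 + 1 : MvPolynomial (Fin 4) K) ∈ 𝔮) :
    pderiv 1 (X 1 ^ 4 + 1 : MvPolynomial (Fin 4) K) = 4 * X 1 ^ 3 ∧ (X 1 : MvPolynomial (Fin 4) K) ∉ 𝔮 ∧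
      ((4 : MvPolynomial (Fin 4) K) ∉ 𝔮 → (4 * X 1 ^ 3 : MvPolynomial (Fin 4) K) ∉ 𝔮) := by
  have e11 := f_self K 1
  have d : pderiv 1 (X 1 ^ 4 + 1 : MvPolynomial (Fin 4) K) = 4 * X 1 ^ 3 := by
    simp only [map_add, Derivation.leibniz_pow, smul_eq_mul, nsmul_eq_mul, e11, f_one]
    push_cast; ring
  have hX1 : (X 1 : MvPolynomial (Fin 4) K) ∉ 𝔮 := fun h1 => by
    have : (1 : MvPolynomial (Fin 4) K) ∈ 𝔮 := by
      have := Ideal.sub_mem _ hh (Ideal.pow_mem_of_mem 𝔮 h1 4 (by norm_num))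
      rwa [add_sub_cancel_left] at this
    exact one_not_mem_of_isPrime 𝔮 this
  refine ⟨d, hX1, fun h4 hmem => ?_⟩
  rcases ‹𝔮.IsPrime›.mem_or_mem hmem with h' | h'
  · exact h4 h'
  · exact hX1 (‹𝔮.IsPrime›.mem_of_pow_mem 3 h')

/-- **TAME along `λ` off the points `Q`**: at a prime `𝔫 ∋ w'` with `h ∉ 𝔫`, `e = w'·h ∈ 𝔫` is a REGULAR PARAMETER
(`s'·w'h ∈ 𝔫²` ⟹ `∂_{w'}`:
`s'h ∈ 𝔫`, absurd).  With `Cx_C_dd`: absolute contact. [new; elementary] [folklore] -/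
theorem Cx_C_tame_lambda (𝔫 : Ideal (MvPolynomial (Fin 4) K)) [𝔫.IsPrime] (h3 : (X 3 : MvPolynomial (Fin 4) K) ∈ 𝔫)
    (hh : (X 1 ^ 4 + 1 : MvPolynomial (Fin 4) K) ∉ 𝔫) :
    (X 3 * (X 1 ^ 4 + 1) : MvPolynomial (Fin 4) K) ∈ 𝔫 ∧ ∀ s' ∉ 𝔫, s' * (X 3 * (X 1 ^ 4 + 1) : MvPolynomial (Fin 4) K) ∉ 𝔫 ^ 2 := by
  refine ⟨Ideal.mul_mem_right _ _ h3, fun s' hs' hmem => ?_⟩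
  have e31 := f_ne K (i := 3) (j := 1) (by decide)
  have e33 := f_self K 3
  have dh : pderiv 3 (X 1 ^ 4 + 1 : MvPolynomial (Fin 4) K) = 0 := by
    simp only [map_add, Derivation.leibniz_pow, smul_eq_mul, nsmul_eq_mul, e31, f_one]; ring
  have hD := derivation_pow_succ_mem (pderiv 3 : Derivation K (MvPolynomial (Fin 4) K) _) _ 1 hmem
  rw [pow_one] at hD
  have e : pderiv 3 (s' * (X 3 * (X 1 ^ 4 + 1)) : MvPolynomial (Fin 4) K) =
      s' * (X 1 ^ 4 + 1) + X 3 * ((X 1 ^ 4 + 1) * pderiv 3 s') := by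
    rw [Derivation.leibniz, Derivation.leibniz, smul_eq_mul, smul_eq_mul, smul_eq_mul, e33, dh]; ring
  rw [e] at hD
  have h' : s' * (X 1 ^ 4 + 1) ∈ 𝔫 := by
    have := Ideal.sub_mem _ hD (Ideal.mul_mem_right ((X 1 ^ 4 + 1) * pderiv 3 s') _ h3)
    rwa [add_sub_cancel_right] at this
  rcases ‹𝔫.IsPrime›.mem_or_mem h' with h'' | h''
  · exact hs' h''
  · exact hh h''

/-- **TAME along `μ` off the points `Q`**: at a prime `𝔫 ∋ h` with `w' ∉ 𝔫`, `e = w'·h` is a regular parameter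
(`∂_β`: `s'·w'·β³ ∈ 𝔫` is
absurd since `β ∉ 𝔫` by `Cx_h_separable`). [new; elementary] [folklore] -/
theorem Cx_C_tame_mu [CharP K 3] (𝔫 : Ideal (MvPolynomial (Fin 4) K)) [𝔫.IsPrime] (hh : (X 1 ^ 4 + 1 : MvPolynomial (Fin 4) K) ∈ 𝔫)
    (h3 : (X 3 : MvPolynomial (Fin 4) K) ∉ 𝔫) :
    (X 3 * (X 1 ^ 4 + 1) : MvPolynomial (Fin 4) K) ∈ 𝔫 ∧ ∀ s' ∉ 𝔫, s' * (X 3 * (X 1 ^ 4 + 1) : MvPolynomial (Fin 4) K) ∉ 𝔫 ^ 2 := by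
  refine ⟨Ideal.mul_mem_left _ _ hh, fun s' hs' hmem => ?_⟩
  have h4 : (4 : MvPolynomial (Fin 4) K) ∉ 𝔫 := by
    have := natCast_not_mem (K := K) 𝔫 (m := 4) (by decide)
    exact_mod_cast this
  obtain ⟨dh, _, hd⟩ := Cx_h_separable 𝔫 hh
  have e13 := f_ne K (i := 1) (j := 3) (by decide)
  have hD := derivation_pow_succ_mem (pderiv 1 : Derivation K (MvPolynomial (Fin 4) K) _) _ 1 hmem
  rw [pow_one] at hD
  have e : pderiv 1 (s' * (X 3 * (X 1 ^ 4 + 1)) : MvPolynomial (Fin 4) K) =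
      s' * X 3 * (4 * X 1 ^ 3) + X 3 * (X 1 ^ 4 + 1) * pderiv 1 s' := by
    rw [Derivation.leibniz, Derivation.leibniz, smul_eq_mul, smul_eq_mul, smul_eq_mul, e13, dh]; ring
  rw [e] at hD
  have h' : s' * X 3 * (4 * X 1 ^ 3) ∈ 𝔫 := by
    have := Ideal.sub_mem _ hD (Ideal.mul_mem_right (pderiv 1 s') _ (Ideal.mul_mem_left _ (X 3) hh))
    rwa [add_sub_cancel_right] at this
  rcases ‹𝔫.IsPrime›.mem_or_mem h' with h'' | h''
  · rcases ‹𝔫.IsPrime›.mem_or_mem h'' with h3' | h3'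
    · exact hs' h3'
    · exact h3 h3'
  · exact hd h4 h''

/-- **WILD at the points `Q = V(α, u, w', h)`**: `g₃ = α³ + r`, `r = u²·w'·h ∈ (α, u, w', h)⁴` (a `3`-power form: no
absolute stalk
contact at `Q`); and a NEAR POINT over `Q` (point chart `u`: `α = x u, w' = y u, h = η u`): `x³ + u·y·η·E ∈ 𝔫'³` for
every cofactor.  So
the `Q` are BAD: bad₃ = `{Q} ∪ {Q'}` (finitely many closed points: `h` univariate, nonzero). [new; elementary] [folklore] -/
theorem Cx_C_wild_near_Q :
    (X 2 ^ 2 * X 3 * (X 1 ^ 4 + 1) : MvPolynomial (Fin 4) K) ∈ (Ideal.span {(X 0 : MvPolynomial (Fin 4) K), X 2, X 3, X 1 ^ 4 + 1}) ^ 4 ∧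
      ∀ E : MvPolynomial (Fin 4) K, (X 0 ^ 3 + X 2 * X 3 * X 1 * E : MvPolynomial (Fin 4) K) ∈
        (Ideal.span {(X 0 : MvPolynomial (Fin 4) K), X 1, X 2, X 3}) ^ 3 := by
  have hq2 : (X 2 : MvPolynomial (Fin 4) K) ∈ Ideal.span {(X 0 : MvPolynomial (Fin 4) K), X 2, X 3, X 1 ^ 4 + 1} :=
    Ideal.subset_span (by simp)
  have hq3 : (X 3 : MvPolynomial (Fin 4) K) ∈ Ideal.span {(X 0 : MvPolynomial (Fin 4) K), X 2, X 3, X 1 ^ 4 + 1} :=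
    Ideal.subset_span (by simp)
  have hqh : (X 1 ^ 4 + 1 : MvPolynomial (Fin 4) K) ∈ Ideal.span {(X 0 : MvPolynomial (Fin 4) K), X 2, X 3, X 1 ^ 4 + 1} :=
    Ideal.subset_span (by simp)
  refine ⟨?_, fun E => ?_⟩
  · have h23 : (X 2 ^ 2 * X 3 : MvPolynomial (Fin 4) K) ∈ (Ideal.span {(X 0 : MvPolynomial (Fin 4) K), X 2, X 3, X 1 ^ 4 + 1}) ^ (2 + 1) :=
      mul_mem_pow_add (Ideal.pow_mem_pow hq2 2) (by rw [pow_one]; exact hq3)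
    exact mul_mem_pow_add h23 (by rw [pow_one]; exact hqh)
  · refine Ideal.add_mem _ (Ideal.pow_mem_pow (X_mem_spanX4 0) 3) ?_
    have h23 : (X 2 * X 3 : MvPolynomial (Fin 4) K) ∈ (Ideal.span {(X 0 : MvPolynomial (Fin 4) K), X 1, X 2, X 3}) ^ (1 + 1) :=
      mul_mem_pow_add (by rw [pow_one]; exact X_mem_spanX4 2) (by rw [pow_one]; exact X_mem_spanX4 3)
    have h231 : (X 2 * X 3 * X 1 : MvPolynomial (Fin 4) K) ∈ (Ideal.span {(X 0 : MvPolynomial (Fin 4) K), X 1, X 2, X 3}) ^ (1 + 1 + 1) :=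
      mul_mem_pow_add h23 (by rw [pow_one]; exact X_mem_spanX4 1)
    exact Ideal.mul_mem_right _ _ h231

/-- **KEY · TWO REFINED LEVELS DOWN, C× IS P∞ along its top locus**: `g₃ = P∞(α, h(β), u, w')` LITERALLY —
substituting `X₁ ↦ h = X₁⁴ + 1`
into P∞ = `X₀³ + X₁·X₂²·X₃` gives `g₃`.  At each `Q` (`h ∈ 𝔮`, `h' ∉ 𝔮`: `Cx_h_separable`) dictionary (E) makes the
germ of R3 at `Q`
P∞'s germ at its origin, with `λ`, `μ` = P∞'s `s`- and `w`-axes: the rest of the refined run over `Q` is P∞'s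
DECIDING separating hop
(`Pinf_perpetual_certificate` (R)/(U)/(Z), `Pinf_sepHeightOne_certificate`). [new; elementary] [folklore] -/
theorem Cx_C_isPinf :
    aeval (fun j : Fin 4 => if j = 1 then (X 1 ^ 4 + 1 : MvPolynomial (Fin 4) K) else X j)
        (X 0 ^ 3 + X 1 * X 2 ^ 2 * X 3 : MvPolynomial (Fin 4) K) =
      X 0 ^ 3 + X 2 ^ 2 * X 3 * (X 1 ^ 4 + 1) := by
  simp; ring

end RefCertificates

end Summit.ResolutionOfSingularities.ResolutionOfSingularities.Theorems.DeltaCutClasses
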